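import Summits.QuantumFields.YangMills.Theorems.MirrorModularBoostsCurvatureBoostCovarianceRayPositivityCore
import Literature.MathematicalPhysics.QuantumFieldTheory.OSBoostChains
import HarnessLib

/-!
# Complex-rotation orbits of a time-ordered support stay in the planar tube — stub `stub_orbitGapsPlanarTube`

Line `complex-rotation-bandlimit` of crux `PencilRigidity.NPointIsotropy` (stmt-QuantumFields-11686),
registered side stub (geometry of complex-rotation orbits) of the skeleton
`Cruxes/NPointIsotropy/Lines/complex_rotation_bandlimit.lean`.

Statement (`stub_orbitGapsPlanarTube`, registered signature verbatim; pure trigonometry and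
compactness, model-blind).  Let `F` be an `e₀`-time-ordered `n`-point test function on `(ℝ⁴)ⁿ` with
compact support.  The complex rotation of the `(x⁰, x¹)`-plane by the complex angle `θ` (tree
convention `planeRot 0 θ`, now with complex `cos`/`sin`) sends a real planar vector `(a, b)` to
`ζ⁰ = cos θ · a + sin θ · b`, `ζ¹ = -sin θ · a + cos θ · b`.  Then there are `ε, δ > 0` such that for
every complex angle with `|Re θ| < ε` and every `x ∈ tsupport F`, every position `(xᵢ⁰, xᵢ¹)` and
every gap `(xⱼ⁰ - xᵢ⁰, xⱼ¹ - xᵢ¹)`, `i < j`, lands in the PLANAR TUBE `{Re ζ⁰ > |Im ζ¹|}` with the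
uniform margin `Re ζ⁰ - |Im ζ¹| ≥ δ · e^{-|Im θ|}`.

Proof.  Write `θ = η + iχ`.  For real `a, b`,
`Re ζ⁰ = cosh χ · (cos η · a + sin η · b)` and `Im ζ¹ = -sinh χ · (cos η · a + sin η · b)`
(`re_rotTime`, `im_rotTransverse`, from the real/imaginary parts of the complex `cos`/`sin` of
`OSBoostChains`: `ChainItem.cos_re`, `ChainItem.sin_im`, …), so when `P := cos η · a + sin η · b ≥ δ ≥ 0`,
`Re ζ⁰ - |Im ζ¹| = (cosh χ - |sinh χ|) P = e^{-|χ|} P ≥ δ e^{-|χ|}` (`ChainItem.cosh_sub_abs_sinh`,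
`tube_margin`).  The real margin
`P > δ` for `|η| < ε`, uniformly over the compact support, is the tube lemma
(`IsCompact.eventually_forall_of_forall_eventually`) applied to the parameter `(η, δ) → (0, 0)`:
at `(η, δ) = (0, 0)` the finitely many conditions read `xᵢ⁰ > 0` and `xⱼ⁰ - xᵢ⁰ > 0` (`i < j`),
which is the time ordering of the support (`exists_realMargin`).

References: K. Osterwalder, R. Schrader, *Axioms for Euclidean Green's functions II*, Comm. Math.
Phys. 42 (1975) 281–305, Ch. V (complex Euclidean rotations of time-ordered configurations);
J. Glimm, A. Jaffe, *Quantum Physics* (1987), §19.5 (holomorphic semigroup factors on the planar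
tube). [folklore]
-/

noncomputable section

-- Mathlib's `SimplexCategory` instance `Fintype (Fin (x.len + 1))` matches `Fintype (Fin 4)` and makes concrete
-- `Fin 4` instance paths diverge between elaborations (tree-known file-local workaround, as in the landed
-- `Negative/*.lean` files of this crux).
attribute [-instance] SimplexCategory.instFintypeToTypeOrderHomFinHAddNatLenOfNat

namespace Summit.QuantumFields.YangMills.Theorems.NPointIsotropy.ComplexRotationBandlimit

open scoped BigOperators SchwartzMap
open MeasureTheory Filter Topology
open Literature.MathematicalPhysics.QuantumLattice Literature.MathematicalPhysics.AQFT
  Literature.MathematicalPhysics.QuantumFieldTheory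
open Summit.QuantumFields.YangMills.Theorems.NPointIsotropy.Negative (E4)

namespace OrbitGapsPlanarTube

/-! ## The complex rotation of a real planar vector: `Re ζ⁰`, `Im ζ¹`, and the tube margin -/

/-- **Real part of the rotated time coordinate**: for real `a, b` and `θ = η + iχ`,
`Re (cos θ · a + sin θ · b) = cosh χ · (cos η · a + sin η · b)`. [folklore] -/
theorem re_rotTime (a b : ℝ) (θ : ℂ) :
    (Complex.cos θ * (a : ℂ) + Complex.sin θ * (b : ℂ)).re =
      Real.cosh θ.im * (Real.cos θ.re * a + Real.sin θ.re * b) := by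
  simp only [Complex.add_re, Complex.mul_re, Complex.ofReal_re, Complex.ofReal_im, ChainItem.cos_re,
    ChainItem.sin_re, mul_zero, sub_zero]
  ring

/-- **Imaginary part of the rotated transverse coordinate**: for real `a, b` and `θ = η + iχ`,
`Im (-sin θ · a + cos θ · b) = -sinh χ · (cos η · a + sin η · b)`. [folklore] -/
theorem im_rotTransverse (a b : ℝ) (θ : ℂ) :
    (-Complex.sin θ * (a : ℂ) + Complex.cos θ * (b : ℂ)).im =
      -(Real.sinh θ.im * (Real.cos θ.re * a + Real.sin θ.re * b)) := by
  simp only [Complex.add_im, Complex.mul_im, Complex.neg_re, Complex.neg_im, Complex.ofReal_re,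
    Complex.ofReal_im, ChainItem.cos_im, ChainItem.sin_im, ChainItem.sin_re, mul_zero, zero_add]
  ring

/-- **The tube margin.**  If the real-angle time coordinate `P = cos η · a + sin η · b` of a real
planar vector is at least `δ ≥ 0`, then its complex rotation by `θ = η + iχ` lies in the planar tube
with margin `Re ζ⁰ - |Im ζ¹| = e^{-|χ|} P ≥ δ e^{-|χ|}`. [folklore] -/
theorem tube_margin {a b δ : ℝ} {θ : ℂ} (hδ : 0 ≤ δ)
    (h : δ ≤ Real.cos θ.re * a + Real.sin θ.re * b) :
    δ * Real.exp (-|θ.im|) ≤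
      (Complex.cos θ * (a : ℂ) + Complex.sin θ * (b : ℂ)).re -
        |(-Complex.sin θ * (a : ℂ) + Complex.cos θ * (b : ℂ)).im| := by
  rw [re_rotTime, im_rotTransverse, abs_neg, abs_mul, abs_of_nonneg (hδ.trans h), ← sub_mul,
    ChainItem.cosh_sub_abs_sinh, mul_comm]
  exact mul_le_mul_of_nonneg_left h (Real.exp_pos _).le

/-! ## The uniform real margin over a compact time-ordered set -/

/-- **Uniform real margin** (tube lemma).  For a compact subset `K` of the open `e₀`-time-ordered
chamber of `(ℝ⁴)ⁿ` there are `ε, δ > 0` such that for every real angle `|η| < ε` and every `x ∈ K`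
all rotated time coordinates `cos η · xᵢ⁰ + sin η · xᵢ¹` and all rotated time gaps
`cos η · (xⱼ⁰ - xᵢ⁰) + sin η · (xⱼ¹ - xᵢ¹)`, `i < j`, exceed `δ`: the finitely many strict
inequalities are open conditions in `((η, δ), x)` that hold at `((0, 0), x)`, `x ∈ K`, by the time
ordering, so `IsCompact.eventually_forall_of_forall_eventually` makes them hold for `(η, δ)` near
`(0, 0)` uniformly in `x ∈ K`. [folklore] -/
theorem exists_realMargin {n : ℕ} {K : Set (Fin n → E4)} (hK : IsCompact K)
    (hKΩ : K ⊆ {x | (∀ i, 0 < x i 0) ∧ StrictMono fun i => x i 0}) :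
    ∃ ε : ℝ, 0 < ε ∧ ∃ δ : ℝ, 0 < δ ∧ ∀ η : ℝ, |η| < ε → ∀ x ∈ K,
      (∀ i : Fin n, δ < Real.cos η * x i 0 + Real.sin η * x i 1) ∧
      (∀ i j : Fin n, i < j →
        δ < Real.cos η * (x j 0 - x i 0) + Real.sin η * (x j 1 - x i 1)) := by
  -- the open conditions, parametrised by `p = (η, δ)`
  set P : ℝ × ℝ → (Fin n → E4) → Prop := fun p x =>
    (∀ i : Fin n, p.2 < Real.cos p.1 * x i 0 + Real.sin p.1 * x i 1) ∧
      (∀ i j : Fin n, i < j →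
        p.2 < Real.cos p.1 * (x j 0 - x i 0) + Real.sin p.1 * (x j 1 - x i 1)) with hP
  have hev : ∀ᶠ p in 𝓝 ((0 : ℝ), (0 : ℝ)), ∀ x ∈ K, P p x := by
    refine hK.eventually_forall_of_forall_eventually fun y hy => ?_
    obtain ⟨hpos, hmono⟩ := hKΩ hy
    have hδc : Continuous fun z : (ℝ × ℝ) × (Fin n → E4) => z.1.2 := by fun_prop
    refine Filter.Eventually.and (Filter.eventually_all.2 fun i => ?_)
      (Filter.eventually_all.2 fun i => Filter.eventually_all.2 fun j =>
        Filter.eventually_imp_distrib_left.2 fun hij => ?_)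
    · have hc : Continuous fun z : (ℝ × ℝ) × (Fin n → E4) =>
          Real.cos z.1.1 * z.2 i 0 + Real.sin z.1.1 * z.2 i 1 := by fun_prop
      refine hδc.continuousAt.eventually_lt hc.continuousAt ?_
      simpa using hpos i
    · have hc : Continuous fun z : (ℝ × ℝ) × (Fin n → E4) =>
          Real.cos z.1.1 * (z.2 j 0 - z.2 i 0) + Real.sin z.1.1 * (z.2 j 1 - z.2 i 1) := by fun_prop
      refine hδc.continuousAt.eventually_lt hc.continuousAt ?_
      simpa using hmono hij
  obtain ⟨ε', hε', hball⟩ := Metric.eventually_nhds_iff.1 hev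
  refine ⟨ε' / 2, half_pos hε', ε' / 2, half_pos hε', fun η hη x hx => ?_⟩
  have hdist : dist (η, ε' / 2) ((0 : ℝ), (0 : ℝ)) < ε' := by
    rw [Prod.dist_eq, Real.dist_0_eq_abs, Real.dist_0_eq_abs, abs_of_pos (half_pos hε')]
    exact max_lt (hη.trans (half_lt_self hε')) (half_lt_self hε')
  exact hball hdist x hx

end OrbitGapsPlanarTube

open OrbitGapsPlanarTube in
/-- **Side stub — GEOMETRY OF COMPLEX-ROTATION ORBITS (registered side stub of the skeleton
`Cruxes/NPointIsotropy/Lines/complex_rotation_bandlimit.lean`, signature verbatim).**  For a compactly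
supported `e₀`-time-ordered `n`-point test function `F` there are `ε, δ > 0` such that for every complex
angle `θ` with `|Re θ| < ε` and every `x ∈ tsupport F`, the complex `(x⁰, x¹)`-rotation by `θ` of every
position `xᵢ` and of every gap `xⱼ - xᵢ` (`i < j`) lies in the planar tube `{Re ζ⁰ > |Im ζ¹|}` with
margin `Re ζ⁰ - |Im ζ¹| ≥ δ e^{-|Im θ|}`: `Re ζ⁰ - |Im ζ¹| = e^{-|Im θ|} (cos η · a + sin η · b)` once the
real-angle time coordinate is non-negative (`tube_margin`), and the latter exceeds `δ` uniformly for
`|η| < ε` on the compact support by the tube lemma (`exists_realMargin`). [folklore] -/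
theorem stub_orbitGapsPlanarTube :
    ∀ (n : ℕ) (F : SchwartzMap (Fin n → EuclideanSpace ℝ (Fin 4)) ℂ),
      Literature.MathematicalPhysics.QuantumLattice.IsTimeOrdered F →
      HasCompactSupport (F : (Fin n → EuclideanSpace ℝ (Fin 4)) → ℂ) →
      ∃ ε : ℝ, 0 < ε ∧ ∃ δ : ℝ, 0 < δ ∧ ∀ θ : ℂ, |θ.re| < ε →
        ∀ x ∈ tsupport (F : (Fin n → EuclideanSpace ℝ (Fin 4)) → ℂ),
          (∀ i : Fin n, δ * Real.exp (-|θ.im|) ≤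
            (Complex.cos θ * ((x i 0 : ℝ) : ℂ) + Complex.sin θ * ((x i 1 : ℝ) : ℂ)).re -
              |(-Complex.sin θ * ((x i 0 : ℝ) : ℂ) + Complex.cos θ * ((x i 1 : ℝ) : ℂ)).im|) ∧
          (∀ i j : Fin n, i < j → δ * Real.exp (-|θ.im|) ≤
            (Complex.cos θ * ((x j 0 - x i 0 : ℝ) : ℂ) + Complex.sin θ * ((x j 1 - x i 1 : ℝ) : ℂ)).re -
              |(-Complex.sin θ * ((x j 0 - x i 0 : ℝ) : ℂ) + Complex.cos θ * ((x j 1 - x i 1 : ℝ) : ℂ)).im|) := by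
  intro n F hF hFc
  obtain ⟨ε, hε, δ, hδ, h⟩ := exists_realMargin hFc.isCompact hF
  refine ⟨ε, hε, δ, hδ, fun θ hθ x hx => ?_⟩
  obtain ⟨h₁, h₂⟩ := h θ.re hθ x hx
  exact ⟨fun i => tube_margin hδ.le (h₁ i).le, fun i j hij => tube_margin hδ.le (h₂ i j hij).le⟩

end Summit.QuantumFields.YangMills.Theorems.NPointIsotropy.ComplexRotationBandlimit

end
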